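import Summits.CriticalPhenomena.CardyFormulaZ2.Theorems.CardyBoundaryCoulombGasRectilinearCardyOfEngineMember
import Summits.CriticalPhenomena.CardyFormulaZ2.Theorems.CardyBoundaryCoulombGasHalfPlaneMarkDensityLawOneArmThirdOfCrux
import Summits.CriticalPhenomena.CardyFormulaZ2.Theorems.CardyBoundaryCoulombGasStripClusterRatesRectCardyOneOfRectilinearCardy
import HarnessLib

/-!
# Line excursion-kernel-covariance of crux RectilinearCardy (stmt-CriticalPhenomena-5660): the POSITION of its last stub

Lead `prover-line-stmt-CriticalPhenomena-5660-c7-0` (cycle 7). The line is closed modulo ONE registered stub,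
`stub_engine1311`, the `(k = 4; L = (1,3,1,1); sink j = 1)` member of the route's engine
`BoundaryDefectGaussianR` (stmt-14132): three weight-`0` boundary-condition-changing insertions at the marks
`d, b, a` and the weight-`1` closure-density insertion at the moving point — Cardy's crossing formula in DENSITY
form, read on the six-vertex / Baxter–Kelland–Wu side. This file records, in the kernel, where that stub sits:

* `engineMember1311_position` — the member ALONE implies the summit conjunct `CardyFormulaZ2` (through the
  landed `rectilinearCardy_of_engineMember1311` of lead c6 and the proved support `RectilinearSuffices`), hence
  also the route's crux 5 `HalfPlaneMarkDensityLaw`, crux 6 `HalfPlaneOneArmThird` and the `γ₁`-half of crux 3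
  `StripClusterRates` (`n·γ₁(n) → π/3` for every family of one-cluster strip rates), by the sibling leads'
  landed necessity theorems;
* `engineMember1311_sandwich` — the member is sandwiched between the engine and the conjunct:
  `BoundaryDefectGaussianR → member` and `member → CardyFormulaZ2`.

Consequence for planners / refuters: no line for this crux can leave standing a stub weaker than Cardy's formula
for bond-`ℤ²` itself (Schramm, ICM 2006, Problem 2.11, open); the member is "conjunct-complete", so it should be
carried as its own statement item (under stmt-14132) on which stmt-5660 parks. No definitions are introduced;
everything is glue over landed theorems.
-/

noncomputable section

open Set Filter Topology MeasureTheory Metric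
open Literature.Probability.RandomPlanarGeometry
open Literature.Probability.Percolation (crossingProb half)
open Literature.Probability.LatticeModels.CollarLegModel (LegInsertionData Zins ofDomain)
open Summit.CriticalPhenomena.CardyFormulaZ2.Theses.CardyBoundaryCoulombGas
  (BoundaryDefectGaussianR RectilinearCardy HalfPlaneMarkDensityLaw HalfPlaneOneArmThird)
open Summit.CriticalPhenomena.CardyFormulaZ2.Cruxes.HalfPlaneMarkDensityLaw.SketchLine
  (rectilinearCardy_iff_cardyFormulaZ2 halfPlaneMarkDensityLaw_of_cardyFormulaZ2)
open Summit.CriticalPhenomena.CardyFormulaZ2.Cruxes.HalfPlaneMarkDensityLaw.SketchLine.OneArm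
  (halfPlaneOneArmThird_of_rectilinearCardy)
open Summit.CriticalPhenomena.CardyFormulaZ2.Cruxes.StripClusterRates.TwoClusterRateIsStationaryGap
  (oneClusterKac_of_rectilinearCardy)

namespace Summit.CriticalPhenomena.CardyFormulaZ2.Cruxes.RectilinearCardy.ExcursionKernelCovariance

/-- **Position of the last stub of the line.** The `(4; (1,3,1,1); 1)` member of the engine (stated
verbatim, as in `rectilinearCardy_of_engineMember1311`) implies: the summit conjunct `CardyFormulaZ2`
(member ⟹ `RectilinearCardy` ⟺ conjunct), the route's crux 5 `HalfPlaneMarkDensityLaw` and crux 6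
`HalfPlaneOneArmThird` (both necessary for the conjunct), and the Kac limit `n·γ₁(n) → π/3` for every family
`γ₁` of one-cluster lengthwise strip rates (the `γ₁`-half of crux 3 `StripClusterRates`).
[cite: Schramm2007ICM, §2.6 Problem 2.11] -/
theorem engineMember1311_position
    (hM : (∃ C : ℝ, 0 < C ∧ ∀ (D : MarkedDomain 4),
        (∃ S : Finset (ℂ × ℂ), (∀ p ∈ S, p.1.re = p.2.re ∨ p.1.im = p.2.im) ∧
          frontier D.carrier ⊆ ⋃ p ∈ S, segment ℝ p.1 p.2) →
        (∀ i, ∃ r : ℝ, 0 < r ∧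
          ((∀ z ∈ frontier D.carrier, dist z (D.pt i) < r → z.im = (D.pt i).im) ∨
            (∀ z ∈ frontier D.carrier, dist z (D.pt i) < r → z.re = (D.pt i).re))) →
        ∀ (w : ℂ → ℂ) (U : Set ℂ), IsOpen U → D.carrier ⊆ U → (∀ i, D.pt i ∈ U) →
          DifferentiableOn ℂ w U → Set.BijOn w D.carrier {z : ℂ | 0 < z.im} →
          (∀ i, ∃ ε : ℝ, 0 < ε ∧
            StrictMonoOn (fun t : ℝ ↦ (w (D.boundary t)).re) (Set.Ioo (D.mark i - ε) (D.mark i + ε))) →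
          ∀ (δ : ℕ → ℝ), (∀ n, 0 < δ n) → Tendsto δ atTop (nhds 0) →
          ∀ (V : ℕ → Finset (ℤ × ℤ)),
            (∀ n, ∀ v : ℤ × ℤ, v ∈ V n ↔
              ((v.1 : ℂ) * δ n + (v.2 : ℂ) * δ n * Complex.I) ∈ closure D.carrier) →
          ∀ (p : ℕ → Fin 4 → ℤ × ℤ), (∀ n, Function.Injective (p n)) →
            (∀ i, Tendsto (fun n ↦ ((p n i).1 : ℂ) * δ n + ((p n i).2 : ℂ) * δ n * Complex.I)
              atTop (nhds (D.pt i))) →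
            (∀ n, LegInsertionData.IsAdmissible
              ⟨(Finset.univ.erase 1).image (p n),
                fun v ↦ ∑ i ∈ (Finset.univ.erase 1).filter (fun i ↦ p n i = v),
                  (![1, 3, 1, 1] : Fin 4 → ℕ) i, p n 1⟩ (V n)) →
            Tendsto (fun n ↦ (δ n) ^ (-(∑ i : Fin 4,
                (if i = (1 : Fin 4) then (1 - ((![1, 3, 1, 1] : Fin 4 → ℕ) 1 : ℝ))
                  else ((![1, 3, 1, 1] : Fin 4 → ℕ) i : ℝ)) *
                  ((if i = (1 : Fin 4) then (1 - ((![1, 3, 1, 1] : Fin 4 → ℕ) 1 : ℝ))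
                    else ((![1, 3, 1, 1] : Fin 4 → ℕ) i : ℝ)) - 1) / 6)) *
                ‖Zins (V n) ⟨(Finset.univ.erase 1).image (p n),
                    fun v ↦ ∑ i ∈ (Finset.univ.erase 1).filter (fun i ↦ p n i = v),
                      (![1, 3, 1, 1] : Fin 4 → ℕ) i, p n 1⟩‖ / ‖(ofDomain (V n)).Z‖) atTop
              (nhds (C * (∏ i : Fin 4, ∏ i' ∈ Finset.univ.filter (fun i' : Fin 4 ↦ i < i'),
                  ‖w (D.pt i) - w (D.pt i')‖ ^
                    ((if i = (1 : Fin 4) then (1 - ((![1, 3, 1, 1] : Fin 4 → ℕ) 1 : ℝ))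
                        else ((![1, 3, 1, 1] : Fin 4 → ℕ) i : ℝ)) *
                      (if i' = (1 : Fin 4) then (1 - ((![1, 3, 1, 1] : Fin 4 → ℕ) 1 : ℝ))
                        else ((![1, 3, 1, 1] : Fin 4 → ℕ) i' : ℝ)) / 3)) *
                ∏ i : Fin 4, ‖deriv w (D.pt i)‖ ^
                  ((if i = (1 : Fin 4) then (1 - ((![1, 3, 1, 1] : Fin 4 → ℕ) 1 : ℝ))
                      else ((![1, 3, 1, 1] : Fin 4 → ℕ) i : ℝ)) *
                    ((if i = (1 : Fin 4) then (1 - ((![1, 3, 1, 1] : Fin 4 → ℕ) 1 : ℝ))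
                      else ((![1, 3, 1, 1] : Fin 4 → ℕ) i : ℝ)) - 1) / 6))))) :
    _root_.CardyFormulaZ2 ∧ HalfPlaneMarkDensityLaw ∧ HalfPlaneOneArmThird ∧
      ∀ γ : ℕ → ℝ, (∀ n : ℕ, 1 ≤ n →
          Tendsto (fun m : ℕ ↦ -Real.log (crossingProb half m n) / (m : ℝ)) atTop (𝓝 (γ n))) →
        Tendsto (fun n : ℕ ↦ (n : ℝ) * γ n) atTop (𝓝 (Real.pi / 3)) := by
  have h₄ : RectilinearCardy := rectilinearCardy_of_engineMember1311 hM
  have hZ2 : _root_.CardyFormulaZ2 := rectilinearCardy_iff_cardyFormulaZ2.1 h₄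
  exact ⟨hZ2, halfPlaneMarkDensityLaw_of_cardyFormulaZ2 hZ2, halfPlaneOneArmThird_of_rectilinearCardy h₄,
    fun γ hγ ↦ oneClusterKac_of_rectilinearCardy h₄ γ hγ⟩

/-- **The last stub is sandwiched between the engine and the conjunct**: the route's engine
`BoundaryDefectGaussianR` gives the `(4; (1,3,1,1); 1)` member by specialisation (`engineMember1311_of_engine`),
and the member gives `RectilinearCardy` (`rectilinearCardy_of_engineMember1311`), which is the conjunct
(`rectilinearCardy_iff_cardyFormulaZ2`); in particular the engine delivers the conjunct through this ONE member.
[cite: Schramm2007ICM, §2.6 Problem 2.11] -/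
theorem engineMember1311_sandwich :
    (BoundaryDefectGaussianR → RectilinearCardy) ∧ (RectilinearCardy ↔ _root_.CardyFormulaZ2) ∧
      (BoundaryDefectGaussianR → _root_.CardyFormulaZ2) :=
  ⟨fun h ↦ rectilinearCardy_of_engineMember1311 (engineMember1311_of_engine h), rectilinearCardy_iff_cardyFormulaZ2,
    fun h ↦ rectilinearCardy_iff_cardyFormulaZ2.1 (rectilinearCardy_of_engineMember1311 (engineMember1311_of_engine h))⟩

end Summit.CriticalPhenomena.CardyFormulaZ2.Cruxes.RectilinearCardy.ExcursionKernelCovariance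

end
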